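import Mathlib
import Summits.PneNP.PneNP.Theorems.CnfIdealGenLengthRankDefectRepresentationsMergeReduction

/-!
# Crux `RankDefectRepresentations` (stmt-PneNP-18923), line `rank-dehn-ladder`: TRIVIAL HALVING — the 2D max-cut decomposition with the
# exponential constant `4 (2^{n'} − 1)` (lead g15 RESHAPE 11, tool stub W9 `stub_trivialHalving`; briefs
# `Cruxes/RankDefectRepresentations/Lines/rank-dehn-ladder-briefs-g15c.md` §W9)

`DoubleMaxCutDecomposition K n n' λ` (`Theorems/…TwoFamilyCutDomination`, p653152): if every double bipartition cut of a matrix `D` coloured by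
`{0,1}^n × {0,1}^{n'}` has rank `≤ c`, then `D = S_I + S_J + L` with `S_I` supported on "first-family colours agree", `S_J` on "second-family
colours agree" and `rank L ≤ λ c`.

THE BASELINE (`doubleMaxCut_trivialHalving`): the decomposition holds UNCONDITIONALLY with `λ = 4 (2^{n'} − 1)` — the kernel baseline against
which every merge / splitting statement of the line is measured (the registered crux tool `stub_doubleMaxCutDecomposition` asks for `λ`
POLYNOMIAL in the number of coordinates).  Proof = the un-crossing induction of `…MergeReduction.doubleMaxCut_of_merge_le` (p702065) /
`…SplitReduction.doubleMaxCut_of_adjacentSplitting_le` (p709975) with the merge / surgery step deleted (`G := 0`, `c₀ := c₁ := c`): at level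
`n'' + 1` with budget `c`, (1) the cross matrix `X` of the last second-family coordinate is an honest one-family instance
(`…MergeReduction.cross_cuts_le`), hence within rank `4c` of a first-family block-diagonal `R′` (`…DoubleMaxCutTwoClasses.exists_blockDiagonal_of_cuts_le`);
(2) BOTH halves `{last bit = b}` of `D` are instances with `n''` second-family coordinates and budget `c` (`…MergeReduction.doubleCut_half_le`),
so the induction hypothesis decomposes each with `rank L_b ≤ 4 (2^{n''} − 1) c`, and the three pieces of a half extend by zero keeping their
support / rank properties (`exists_halfPieces_of_decomposition`: inside a half a differing second-family coordinate is never the last one,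
`…MergeReduction.exists_castSucc_ne`; ranks by `…CutLemmaMonotoneCuts.rank_pad_le` — the zero-extension of `…SplitReduction.exists_halfPieces`
packaged with the application of the decomposition hypothesis to the half); (3) with `S_I := R′ + pad S_I⁰ + pad S_I¹`, `S_J := pad S_J⁰ + pad S_J¹`
one has ENTRYWISE `D − S_I − S_J = (X − R′) + pad L⁰ + pad L¹` (on cross cells all pads vanish and `X = D`; on a half cell `X = 0` and the pads
of that half sum to `D`), so `rank ≤ 4c + 2 · 4 (2^{n''} − 1) c = 4 (2^{n''+1} − 1) c` (`const_succ`).  Level `0`: all second-family colours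
agree, `S_I := 0, S_J := D`.
HONEST FRAMING: elementary bookkeeping (the trivial exponential bound); the crux stays open; P ≠ NP is not moved; F-N2 is a FRONTIER formal rung.
-/

set_option linter.dupNamespace false -- `Summit.PneNP.PneNP.…`: summit = sub-problem name (D-0017)

namespace Summit.PneNP.PneNP.Theorems.CnfIdealGenLengthRankDefectRepresentationsTrivialHalving

open Matrix Finset
open Summit.PneNP.PneNP.Theorems.CnfIdealGenLengthRankDefectRepresentationsMergeLowerBound (rank_add_le')
open Summit.PneNP.PneNP.Theorems.CnfIdealGenLengthRankDefectRepresentationsCutLemmaMonotoneCuts (rank_pad_le)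
open Summit.PneNP.PneNP.Theorems.CnfIdealGenLengthRankDefectRepresentationsDoubleMaxCutTwoClasses (exists_blockDiagonal_of_cuts_le)
open Summit.PneNP.PneNP.Theorems.CnfIdealGenLengthRankDefectRepresentationsTwoFamilyCutDomination
  (colourI colourJ maskJ doubleCut DoubleMaxCutDecomposition)
open Summit.PneNP.PneNP.Theorems.CnfIdealGenLengthRankDefectRepresentationsMergeReduction
  (lastR lastC cross_cuts_le rowHalf colHalf liftJ doubleCut_half_le exists_castSucc_ne)

variable {K : Type} [Field K]

/-! ## The three pieces of a decomposed half, extended by zero -/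

section Tools

variable {ι ι' : Type} [Fintype ι] [Fintype ι'] [DecidableEq ι] [DecidableEq ι']

variable {n n' : ℕ} (row : ι → Fin n ⊕ Fin (n' + 1) → Bool) (col : ι' → Fin n ⊕ Fin (n' + 1) → Bool)

/-- **HALF DECOMPOSITION, EXTENDED BY ZERO, piece by piece.**  If the 2D max-cut decomposition holds at level `n'` with constant `λ`, then for
a two-family instance `D` with `n' + 1` second-family coordinates all of whose double bipartition cuts have rank `≤ c` and a bit `b`, the HALF
`{last bit = b}` (an instance with `n'` second-family coordinates and budget `c`, `…MergeReduction.doubleCut_half_le`) decomposes, and its three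
pieces extend by zero to matrices on the whole index set — `S_I'` vanishing wherever a first-family coordinate differs, `S_J'` vanishing wherever
ANY second-family coordinate differs (inside the half a differing coordinate is not the last one; outside it is zero anyway), `L'` of rank
`≤ λ c` — whose sum is `D` on the cells of the half and `0` elsewhere. -/
theorem exists_halfPieces_of_decomposition {lam : ℕ} (h : DoubleMaxCutDecomposition K n n' lam) (D : Matrix ι ι' K) (c : ℕ)
    (hc : ∀ B B', doubleCut row col B B' D ≤ c) (b : Bool) :
    ∃ SI' SJ' L' : Matrix ι ι' K,
      (∀ x y, (∃ k, row x (Sum.inl k) ≠ col y (Sum.inl k)) → SI' x y = 0) ∧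
      (∀ x y, (∃ k', row x (Sum.inr k') ≠ col y (Sum.inr k')) → SJ' x y = 0) ∧
      L'.rank ≤ lam * c ∧
      ∀ x y, SI' x y + SJ' x y + L' x y =
        if row x (Sum.inr (Fin.last n')) = b ∧ col y (Sum.inr (Fin.last n')) = b then D x y else 0 := by
  classical
  -- the half is an instance with budget `c`, so the hypothesis decomposes it
  have hcb : ∀ B B', doubleCut (rowHalf row b) (colHalf col b) B B' (D.submatrix Subtype.val Subtype.val) ≤ c :=
    fun B B' => (doubleCut_half_le row col b D B B').trans (hc B (liftJ B'))
  obtain ⟨SI, SJ, hSI, hSJ, hL⟩ :=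
    h {x : ι // lastR row x = b} {y : ι' // lastC col y = b} (rowHalf row b) (colHalf col b)
      (D.submatrix Subtype.val Subtype.val) c hcb
  -- zero-extension of the three pieces
  set X : Matrix {x : ι // lastR row x = b} {y : ι' // lastC col y = b} K := D.submatrix Subtype.val Subtype.val - SI - SJ with hX
  refine ⟨Matrix.of fun x y => if hx : lastR row x = b then (if hy : lastC col y = b then SI ⟨x, hx⟩ ⟨y, hy⟩ else 0) else 0,
    Matrix.of fun x y => if hx : lastR row x = b then (if hy : lastC col y = b then SJ ⟨x, hx⟩ ⟨y, hy⟩ else 0) else 0,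
    Matrix.of fun x y => if hx : lastR row x = b then (if hy : lastC col y = b then X ⟨x, hx⟩ ⟨y, hy⟩ else 0) else 0,
    ?_, ?_, (rank_pad_le _ _ X).trans hL, ?_⟩
  · rintro x y ⟨k, hk⟩
    simp only [Matrix.of_apply]
    by_cases hx : lastR row x = b
    · by_cases hy : lastC col y = b
      · rw [dif_pos hx, dif_pos hy]
        exact hSI _ _ ⟨k, hk⟩
      · rw [dif_pos hx, dif_neg hy]
    · rw [dif_neg hx]
  · rintro x y hJ
    simp only [Matrix.of_apply]
    by_cases hx : lastR row x = b
    · by_cases hy : lastC col y = b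
      · rw [dif_pos hx, dif_pos hy]
        obtain ⟨k'', hk''⟩ := exists_castSucc_ne row col hx hy hJ
        exact hSJ _ _ ⟨k'', hk''⟩
      · rw [dif_pos hx, dif_neg hy]
    · rw [dif_neg hx]
  · intro x y
    simp only [Matrix.of_apply]
    by_cases hx : lastR row x = b
    · by_cases hy : lastC col y = b
      · rw [dif_pos hx, dif_pos hy, dif_pos hx, dif_pos hy, dif_pos hx, dif_pos hy, if_pos ⟨hx, hy⟩, hX]
        simp only [Matrix.sub_apply, Matrix.submatrix_apply]
        ring
      · rw [dif_pos hx, dif_neg hy, dif_pos hx, dif_neg hy, dif_pos hx, dif_neg hy, if_neg (fun h => hy h.2)]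
        ring
    · rw [dif_neg hx, dif_neg hx, dif_neg hx, if_neg (fun h => hx h.1)]
      ring

end Tools

/-! ## The induction -/

/-- The level constants: `4 + 2 · 4 (2^{n'} − 1) = 4 (2^{n'+1} − 1)` (natural-number arithmetic, `1 ≤ 2^{n'}`). -/
theorem const_succ (n' : ℕ) : 4 + 2 * (4 * (2 ^ n' - 1)) = 4 * (2 ^ (n' + 1) - 1) := by
  have h : 1 ≤ 2 ^ n' := Nat.one_le_two_pow
  rw [pow_succ]
  omega

/-- **TRIVIAL HALVING: the 2D max-cut decomposition with constant `4 (2^{n'} − 1)`** — un-crossing along the second-family coordinates one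
at a time, without any merging: `DoubleMaxCutDecomposition K n n' (4 (2^{n'} − 1))`. -/
theorem doubleMaxCut_trivialHalving (n n' : ℕ) : DoubleMaxCutDecomposition K n n' (4 * (2 ^ n' - 1)) := by
  induction n' with
  | zero =>
      intro ι ι' _ _ _ _ row col D c hc
      refine ⟨0, D, fun _ _ _ => rfl, ?_, by simp⟩
      rintro x y ⟨k', -⟩
      exact k'.elim0
  | succ n'' ih =>
      intro ι ι' _ _ _ _ row col D c hc
      classical
      -- (1) the cross matrix is within `4c` of a first-family block-diagonal matrix
      set X : Matrix ι ι' K := Matrix.of fun x y => if lastR row x ≠ lastC col y then D x y else 0 with hXdef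
      obtain ⟨R', hR', hXR'⟩ := exists_blockDiagonal_of_cuts_le (fun x => colourI (row x)) (fun y => colourI (col y)) X c
        (cross_cuts_le row col D c hc)
      -- (2) the induction hypothesis on the two halves of `D` (budget `c` each), extended by zero piece by piece
      obtain ⟨SI₀, SJ₀, L₀, hSI₀, hSJ₀, hL₀, he₀⟩ := exists_halfPieces_of_decomposition row col ih D c hc false
      obtain ⟨SI₁, SJ₁, L₁, hSI₁, hSJ₁, hL₁, he₁⟩ := exists_halfPieces_of_decomposition row col ih D c hc true
      -- (3) assemble
      refine ⟨R' + SI₀ + SI₁, SJ₀ + SJ₁, ?_, ?_, ?_⟩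
      · rintro x y ⟨k, hk⟩
        have hne : colourI (row x) ≠ colourI (col y) := fun h => hk (congrFun h k)
        rw [Matrix.add_apply, Matrix.add_apply, hR' x y hne, hSI₀ x y ⟨k, hk⟩, hSI₁ x y ⟨k, hk⟩, add_zero, add_zero]
      · intro x y hk
        rw [Matrix.add_apply, hSJ₀ x y hk, hSJ₁ x y hk, add_zero]
      · have e : D - (R' + SI₀ + SI₁) - (SJ₀ + SJ₁) = (X - R') + L₀ + L₁ := by
          ext x y
          have h0 := he₀ x y
          have h1 := he₁ x y
          simp only [Matrix.sub_apply, Matrix.add_apply, hXdef, Matrix.of_apply]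
          rcases Bool.eq_false_or_eq_true (row x (Sum.inr (Fin.last n''))) with hx | hx <;>
            rcases Bool.eq_false_or_eq_true (col y (Sum.inr (Fin.last n''))) with hy | hy
          · -- both `true`: a half cell
            have hxy : row x (Sum.inr (Fin.last n'')) = col y (Sum.inr (Fin.last n'')) := by rw [hx, hy]
            rw [hx, hy] at h0 h1
            simp only [Bool.true_eq_false, and_self, if_false, if_true] at h0 h1
            rw [if_neg (not_not_intro hxy)]
            linear_combination -h0 - h1
          · -- cross cell
            have hxy : row x (Sum.inr (Fin.last n'')) ≠ col y (Sum.inr (Fin.last n'')) := by rw [hx, hy]; decide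
            rw [hx, hy] at h0 h1
            simp only [Bool.true_eq_false, Bool.false_eq_true, and_false, false_and, if_false] at h0 h1
            rw [if_pos hxy]
            linear_combination -h0 - h1
          · -- cross cell
            have hxy : row x (Sum.inr (Fin.last n'')) ≠ col y (Sum.inr (Fin.last n'')) := by rw [hx, hy]; decide
            rw [hx, hy] at h0 h1
            simp only [Bool.true_eq_false, Bool.false_eq_true, and_false, false_and, if_false] at h0 h1
            rw [if_pos hxy]
            linear_combination -h0 - h1
          · -- both `false`: a half cell
            have hxy : row x (Sum.inr (Fin.last n'')) = col y (Sum.inr (Fin.last n'')) := by rw [hx, hy]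
            rw [hx, hy] at h0 h1
            simp only [Bool.false_eq_true, and_self, if_false, if_true] at h0 h1
            rw [if_neg (not_not_intro hxy)]
            linear_combination -h0 - h1
        rw [e]
        calc ((X - R') + L₀ + L₁).rank ≤ (X - R').rank + L₀.rank + L₁.rank :=
              (rank_add_le' _ _).trans (Nat.add_le_add_right (rank_add_le' _ _) _)
          _ ≤ 4 * c + 4 * (2 ^ n'' - 1) * c + 4 * (2 ^ n'' - 1) * c := Nat.add_le_add (Nat.add_le_add hXR' hL₀) hL₁
          _ = (4 + 2 * (4 * (2 ^ n'' - 1))) * c := by ring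
          _ = 4 * (2 ^ (n'' + 1) - 1) * c := by rw [const_succ]

/-- **TOOL stub W9 `stub_trivialHalving` (lead g15 RESHAPE 11), the registered signature verbatim: the 2D max-cut decomposition
`DoubleMaxCutDecomposition K n n' (4 (2^{n'} − 1))` holds over every field, for all `n, n'` — the trivial (exponential in the number of
second-family coordinates) baseline, by un-crossing without merging.** -/
theorem stub_trivialHalving :
    ∀ (K : Type) [Field K] (n n' : ℕ), Summit.PneNP.PneNP.Theorems.CnfIdealGenLengthRankDefectRepresentationsTwoFamilyCutDomination.DoubleMaxCutDecomposition K n n' (4 * (2 ^ n' - 1)) :=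
  fun _ _ n n' => doubleMaxCut_trivialHalving n n'

end Summit.PneNP.PneNP.Theorems.CnfIdealGenLengthRankDefectRepresentationsTrivialHalving
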